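import Summits.AtomisticToContinuum.FouriersLaw.Theses.CoercivePulse
import Literature.MathematicalPhysics.KineticTheory.InfiniteChainAbelWitness

/-!
# `LinearSpread` / Negative: frozen flows are excluded by the crux's guard

Support file (`--supports stmt-AtomisticToContinuum-15382`) of the crux-attack (vetting) seat of the crux
`CoercivePulse.LinearSpread` (stmt-AtomisticToContinuum-15382, route `CoercivePulse` of
`AtomisticToContinuum/FouriersLaw`).  The crux is NOT refuted; this file lands, importably, the small-model facts
that close the one cheap refutation avenue of every pulse crux of the route (`LinearSpread`, `LinearCeiling`,
`AbelRegularity`, `PulseCalculus`: all quantify over `D : InfiniteChainDynamics (pinnedChain …)` with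
`D.PreservesMeasure μ`, `μ` a DLR Gibbs state): the IDENTITY / FROZEN dynamics, under which the pulse
`S(x,t) = Cov(h_0, h_x ∘ φ_t)` would not depend on `t`, its Helfand moment `M(t)` would be constant and
`LinearSpread` (`m·t ≤ M(t)` eventually, `m > 0`) would fail.

The junk analysis already landed in `Literature/…/InfiniteChainAbelWitness` (§2–§3 there) gives: the empty-carrier
dynamics preserves only `μ = 0` (`InfiniteChainDynamics.measure_eq_zero_of_carrier_empty`), a constant orbit has
zero momenta (`OscillatorChain.momenta_zero_of_const_isSolution`), and DLR states charge no coordinate VALUE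
(`IsChainGibbsMeasure.measure_coord_eq_zero`, the point set `{σ | σ 0 = v}`).  Excluding a frozen flow needs the
null set `{σ | (σ 0).2 = 0}` — a hyperplane in the `0`-th coordinate, an uncountable union of such points — which
is what this file adds:

* `chainSpecification_singleton_apply_momentum_zero`, `measure_momentum_zero_of_isChainGibbsMeasure` — the
  single-site DLR kernel, hence every DLR Gibbs state of any chain at any `T`, gives zero mass to `{p_x = 0}`
  (the kernel is a tilting of Lebesgue measure on the `x`-coordinates, and `ℝ × {0}` is Lebesgue-null);
* `momentum_zero_of_frozen_flow`, `not_preservesMeasure_gibbs_of_frozen_flow` — a frozen flow (`φ_t = φ_0`) carries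
  only configurations with all momenta zero, so it preserves no Gibbs state;
* `exists_trivial_dynamics`, `carrier_nonempty_and_flow_not_frozen` — `InfiniteChainDynamics P` is inhabited for
  EVERY chain (empty carrier; no `U'(0) = 0` needed, cf. `restDynamics`), and under the guard of the pulse cruxes
  (`IsChainGibbsMeasure T μ`, `D.PreservesMeasure μ`) the carrier is non-empty and the flow is not frozen.

Consequence for refuters: an unconditional `¬ LinearSpread` must exhibit a genuine Gibbs state with a genuine
`μ`-a.e. infinite-volume Hamiltonian flow — the content of the route's `SymmetricSetup`
(stmt-AtomisticToContinuum-11036).  No new definitions.  Refuter seat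
refuter-rattack-stmt-AtomisticToContinuum-15382-0, 2026-08-17.
-/

noncomputable section

namespace Summit.AtomisticToContinuum.FouriersLaw.Theorems.LinearSpread.Negative

open MeasureTheory Set
open Literature.MathematicalPhysics.KineticTheory.HeatConduction
open Literature.Probability.LatticeModels

/-! ## §1 DLR Gibbs states do not charge `{p_x = 0}` -/

/-- The single-site kernel `γ_{{x}}(· | η)` of the chain specification gives zero mass to `{p_x = 0}`: it is a
tilting of Lebesgue measure on the `x`-coordinates glued with `η`, and `ℝ × {0}` is Lebesgue-null in `ℝ × ℝ`.
[folklore] -/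
theorem chainSpecification_singleton_apply_momentum_zero (P : OscillatorChain) (T : ℝ) (x : ℤ)
    (η : ChainConfig) :
    P.chainSpecification T {x} η {σ | (σ x).2 = 0} = 0 := by
  classical
  have hA : MeasurableSet {σ : ChainConfig | (σ x).2 = 0} :=
    (measurable_pi_apply x).snd (measurableSet_singleton 0)
  unfold OscillatorChain.chainSpecification gibbsSpecOfPotential
  refine (tilted_absolutelyContinuous _ _) ?_
  rw [Measure.map_apply (measurable_glueWith _ _) hA]
  have hsub : (fun ζ : (({x} : Finset ℤ)) → ℝ × ℝ => glueWith {x} ζ η) ⁻¹' {σ | (σ x).2 = 0} ⊆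
      Set.pi univ (fun _ : (({x} : Finset ℤ)) => (univ : Set ℝ) ×ˢ ({0} : Set ℝ)) := by
    intro ζ hζ
    simp only [mem_preimage, mem_setOf_eq, glueWith_apply_mem _ _ _ (Finset.mem_singleton_self x)] at hζ
    intro i _
    have hi : i = ⟨x, Finset.mem_singleton_self x⟩ := Subsingleton.elim _ _
    subst hi
    exact ⟨mem_univ _, hζ⟩
  refine measure_mono_null hsub ?_
  rw [Measure.pi_pi]
  apply Finset.prod_eq_zero (Finset.mem_univ ⟨x, Finset.mem_singleton_self x⟩)
  rw [Measure.volume_eq_prod, Measure.prod_prod]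
  simp

/-- Every DLR Gibbs state of the chain (any `P`, any `T`) gives zero mass to the hyperplane `{p_x = 0}` (DLR
equation in the volume `{x}`); strengthens the point statement `IsChainGibbsMeasure.measure_coord_eq_zero`.
[folklore] -/
theorem measure_momentum_zero_of_isChainGibbsMeasure {P : OscillatorChain} {T : ℝ} {μ : Measure ChainConfig}
    (hμ : P.IsChainGibbsMeasure T μ) (x : ℤ) : μ {σ | (σ x).2 = 0} = 0 := by
  have hA : MeasurableSet {σ : ChainConfig | (σ x).2 = 0} :=
    (measurable_pi_apply x).snd (measurableSet_singleton 0)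
  rw [← hμ.2 {x} _ hA]
  simp [chainSpecification_singleton_apply_momentum_zero]

/-! ## §2 Frozen flows preserve no Gibbs state -/

/-- A frozen flow (`φ_t = φ_0` for all `t`) can carry only configurations with all momenta zero: the orbit of
`σ ∈ carrier` is the constant curve `σ`, and `OscillatorChain.momenta_zero_of_const_isSolution` applies.
[folklore] -/
theorem momentum_zero_of_frozen_flow {P : OscillatorChain} (D : InfiniteChainDynamics P)
    (hfrozen : ∀ t σ, D.flow t σ = D.flow 0 σ) {σ : ChainConfig} (hσ : σ ∈ D.carrier) (i : ℤ) :
    (σ i).2 = 0 := by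
  have hconst : (fun t => D.flow t σ) = fun _ : ℝ => σ := by
    funext t; rw [hfrozen t σ, D.flow_zero σ hσ]
  have hsol := D.isSolution σ hσ
  rw [hconst] at hsol
  exact OscillatorChain.momenta_zero_of_const_isSolution hsol i

/-- No dynamics with a frozen flow preserves a Gibbs state of the chain: the identity dynamics, for which the pulse
`S(x,t) = Cov(h_0, h_x ∘ φ_t)` would not depend on `t` (so that `LinearSpread` would fail with `M` constant), is
excluded by the carrier clause of `PreservesMeasure` together with `isSolution`. [folklore] -/
theorem not_preservesMeasure_gibbs_of_frozen_flow {P : OscillatorChain} (D : InfiniteChainDynamics P)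
    (hfrozen : ∀ t σ, D.flow t σ = D.flow 0 σ) {T : ℝ} {μ : Measure ChainConfig}
    (hμ : P.IsChainGibbsMeasure T μ) : ¬ D.PreservesMeasure μ := by
  intro hD
  have h1 : ∀ᵐ σ ∂μ, (σ 0).2 = 0 := hD.1.mono fun σ hσ => momentum_zero_of_frozen_flow D hfrozen hσ 0
  have h2 : μ {σ | (σ 0).2 = 0} = 0 := measure_momentum_zero_of_isChainGibbsMeasure hμ 0
  have h3 : μ {σ | ¬ (σ 0).2 = 0} = 0 := by rw [ae_iff] at h1; exact h1
  have huniv : μ univ = 0 := by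
    have : (univ : Set ChainConfig) = {σ | (σ 0).2 = 0} ∪ {σ | ¬ (σ 0).2 = 0} := by
      ext σ; simp [em]
    rw [this]
    exact measure_union_null h2 h3
  have := hμ.isProbabilityMeasure
  rw [measure_univ] at huniv
  exact one_ne_zero huniv

/-! ## §3 Read-back against the guard of the pulse cruxes -/

/-- `InfiniteChainDynamics P` is inhabited for every chain `P` (empty carrier, identity flow: every field of the
structure is vacuous; no `U'(0) = 0` is needed, unlike `OscillatorChain.restDynamics`).  So the `∀ D` of the pulse
cruxes is never vacuous for lack of a `D`; what makes a `D` genuine is only the guard `PreservesMeasure`.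
[folklore] -/
theorem exists_trivial_dynamics (P : OscillatorChain) :
    ∃ D : InfiniteChainDynamics P, D.carrier = ∅ ∧ ∀ t σ, D.flow t σ = σ :=
  ⟨{ carrier := ∅
     flow := fun _ σ => σ
     mapsTo := fun _ _ h => h
     flow_zero := fun _ _ => rfl
     isSolution := fun _ h => absurd h (Set.notMem_empty _)
     unique := fun _ hγ _ _ => absurd (hγ 0) (Set.notMem_empty _) }, rfl, fun _ _ => rfl⟩

/-- Under the guard of the pulse cruxes on `(μ, D)` — a DLR Gibbs state preserved by `D` — the carrier of `D` is
non-empty and its flow is not frozen: neither junk inhabitant of `InfiniteChainDynamics` can be fed to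
`LinearSpread`. [folklore] -/
theorem carrier_nonempty_and_flow_not_frozen {P : OscillatorChain} {T : ℝ} {μ : Measure ChainConfig}
    (hμ : P.IsChainGibbsMeasure T μ) (D : InfiniteChainDynamics P) (hD : D.PreservesMeasure μ) :
    D.carrier.Nonempty ∧ ¬ ∀ t σ, D.flow t σ = D.flow 0 σ := by
  refine ⟨?_, fun hfrozen => not_preservesMeasure_gibbs_of_frozen_flow D hfrozen hμ hD⟩
  by_contra h
  have h0 := D.measure_eq_zero_of_carrier_empty (Set.not_nonempty_iff_eq_empty.mp h) hD
  have := hμ.isProbabilityMeasure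
  subst h0
  exact zero_ne_one (measure_univ (μ := (0 : Measure ChainConfig)))

end Summit.AtomisticToContinuum.FouriersLaw.Theorems.LinearSpread.Negative

end
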